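import Mathlib
import HarnessLib
import Literature.MathematicalPhysics.QuantumFieldTheory.StrongCouplingTorusLimit
import Summits.QuantumFields.YangMills.Theorems.PencilRigidityCurvatureKernelBoundTorusFiniteSizeRateExpect
import Summits.QuantumFields.YangMills.Theorems.ConvexGribovBodyStrongCouplingShapeTorusBound

/-!
# `CurvatureKernelBound` — brick `TorusFiniteSizeRate`: quantitative finite-size control of torus
# Wilson expectations at strong coupling
# (crux stmt-QuantumFields-11687, line `coupling-trichotomy`)

`Literature.MathematicalPhysics.QuantumFieldTheory.StrongCouplingTorusLimit` proves that the torus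
Wilson expectations `⟨F ∘ torusLift⟩_{Λ_{L+1}, β}` of a bounded measurable local observable converge,
for `|β| < betaOne d ρ / 4`, to the free infinite-volume limit (`torus_tendsto_wilsonExpectation`),
qualitatively. With the explicit cross-stabilisation of jets of the support files
`…TorusFiniteSizeRateCrossStab` (`cstabE_single`) and `…TorusFiniteSizeRateExpect` (`cstabE`,
`cstabE_expect`), the Schwarz lemma with multiplicity gives the quantitative limit
`‖⟨F⟩^T_{L+1}(β) - g_F(β)‖ ≤ 4 M_F 2^{-n}` on `‖β‖ ≤ β₁/4` for `2 (r + n + 3) ≤ L`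
(`norm_texpect_sub_le`), and choosing `n = L - R - 3` yields the registered statement
`TorusFiniteSizeRate` (in `d = 4`): an exponential finite-size rate `A e^{-(log 2)(L - R)}` with `A`
depending only on the number of bonds in the support (`StrongCouplingShape.card_seedsOf_le` of
`…ConvexGribovBodyStrongCouplingShapeTorusBound`), the infinite-volume value
being the box limit of the free-boundary expectations (boxes are cofinal, `tendsto_box_atTop_atTop`,
and `zdExpect_eq`).

## References

* K. Osterwalder, E. Seiler, *Gauge field theories on a lattice*, Ann. Phys. 110 (1978) 440–471,
  §3, Thms. 3.6–3.7 [OsterwalderSeilerAnnPhys1978].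
* E. Seiler, *Gauge Theories as a Problem of Constructive Quantum Field Theory and Statistical
  Mechanics*, LNP 159 (1982), Ch. 2–3 [SeilerLNP1982].
-/

noncomputable section

open scoped BigOperators Topology
open MeasureTheory Filter
open Literature.MathematicalPhysics Literature.MathematicalPhysics.QuantumFieldTheory
open Literature.Probability.LatticeModels

namespace Summit.QuantumFields.YangMills.Theorems.CurvatureKernel

variable {d N : ℕ} {G : Type*}

section CrossStab

variable [Group G] [TopologicalSpace G] [IsTopologicalGroup G] [CompactSpace G] [MeasurableSpace G]
  [BorelSpace G] {ρ : G →* Matrix (Fin N) (Fin N) ℂ}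

/-! ### The quantitative infinite-volume limit of the torus expectations -/

/-- **Quantitative torus limit.** For a bounded measurable observable `F` (`‖F‖ ≤ C`) supported on
bonds based within sup-distance `r` of a lattice point, every order `n`, every `L` with
`2 (r + n + 3) ≤ L` and `‖β‖ ≤ betaOne d ρ / 4`: the torus expectation `⟨F ∘ (· ∘ τ)⟩^T_{L+1}(β)`
differs from the limit `a` of the free expectations `⟨F⟩_Λ(β)` along all finite regions by at most
`4 M 2^{-n}`, `M = C (2 e^{1/2})^{|seedsOf B|}` (explicit cross-stabilisation of jets + uniform
bounds + the Schwarz lemma with multiplicity, as in `torus_tendsto_expect`). [folklore] -/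
theorem norm_texpect_sub_le (hρ : Continuous ρ) {B : Finset (ZdEdge d)} {F : ZdGaugeConfig d G → ℂ}
    (hFm : Measurable F) {C : ℝ} (hFb : ∀ U, ‖F U‖ ≤ C) (hFB : DependsOn F (B : Set (ZdEdge d)))
    {c : Literature.Probability.LatticeModels.Site d} {r n L : ℕ}
    (hBc : ∀ e ∈ B, ∀ k, (e.1 k - c k).natAbs ≤ r) (hL : 2 * (r + n + 3) ≤ L)
    {β : ℂ} (hβ : ‖β‖ ≤ betaOne d ρ / 4) {a : ℂ}
    (ha : Tendsto (fun Λ => expect ρ F Λ β) atTop (𝓝 a)) :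
    ‖texpect ρ (L + 1) F β - a‖ ≤
      4 * (C * (2 * Real.exp (1 / 2)) ^ (Plaq.seedsOf B).card) * (1 / 2) ^ n := by
  set b := betaOne d ρ with hb
  have hb0 : 0 < b := betaOne_pos d
  set M : ℝ := C * (2 * Real.exp (1 / 2)) ^ (Plaq.seedsOf B).card with hM
  have hM0 : 0 ≤ M := (norm_nonneg _).trans
    (norm_expect_le hρ (β := 0) (by rw [norm_zero]; exact hb0.le) hFm hFb hFB ∅)
  -- Schwarz lemma for a pair of expectations with the same jet
  have schwarz : ∀ {u v : ℂ → ℂ} {n : ℕ}, DifferentiableOn ℂ u (Metric.ball 0 b) →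
      DifferentiableOn ℂ v (Metric.ball 0 b) → (∀ z : ℂ, ‖z‖ ≤ b → ‖u z‖ ≤ M) →
      (∀ z : ℂ, ‖z‖ ≤ b → ‖v z‖ ≤ M) → JetEq n u v → ‖u β - v β‖ ≤ 2 * M * (1 / 2) ^ n := by
    intro u v n hu hv hbu hbv hj
    have hdiff : DifferentiableOn ℂ (fun z => u z - v z) (Metric.ball 0 b) := hu.sub hv
    have hbd : ∀ z ∈ Metric.ball (0 : ℂ) b, ‖u z - v z‖ ≤ 2 * M := by
      intro z hz
      rw [Metric.mem_ball, dist_zero_right] at hz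
      calc ‖u z - v z‖ ≤ ‖u z‖ + ‖v z‖ := norm_sub_le _ _
        _ ≤ M + M := add_le_add (hbu z hz.le) (hbv z hz.le)
        _ = 2 * M := by ring
    have h := norm_le_of_isBigO_pow hdiff hbd hj (r := b / 2) (by positivity) (by linarith)
      (z := β) (by linarith)
    have hq : ‖β‖ / (b / 2) ≤ 1 / 2 := by
      rw [div_le_iff₀ (by positivity)]
      linarith
    calc ‖u β - v β‖ ≤ 2 * M * (‖β‖ / (b / 2)) ^ n := h
      _ ≤ 2 * M * (1 / 2) ^ n :=
          mul_le_mul_of_nonneg_left (pow_le_pow_left₀ (by positivity) hq n) (by positivity)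
  obtain ⟨Λ₀, hZ, hT⟩ := cstabE_expect hρ hFm hFb hFB n
  have hbZ : ∀ Λ (z : ℂ), ‖z‖ ≤ b → ‖expect ρ F Λ z‖ ≤ M := fun Λ z hz =>
    norm_expect_le hρ hz hFm hFb hFB Λ
  have h1 : ‖texpect ρ (L + 1) F β - expect ρ F Λ₀ β‖ ≤ 2 * M * (1 / 2) ^ n :=
    schwarz (differentiableOn_texpect hρ L hFm hFb) (differentiableOn_expect hρ hFm hFb Λ₀)
      (fun z hz => norm_texpect_le hρ hz L hFm hFb hFB) (hbZ Λ₀) (hT c r L hBc hL)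
  have h2 : ‖a - expect ρ F Λ₀ β‖ ≤ 2 * M * (1 / 2) ^ n := by
    refine le_of_tendsto ((ha.sub_const (expect ρ F Λ₀ β)).norm) ?_
    filter_upwards [eventually_ge_atTop Λ₀] with Λ hΛ
    exact schwarz (differentiableOn_expect hρ hFm hFb Λ) (differentiableOn_expect hρ hFm hFb Λ₀)
      (hbZ Λ) (hbZ Λ₀) (hZ Λ hΛ)
  calc ‖texpect ρ (L + 1) F β - a‖
      = ‖(texpect ρ (L + 1) F β - expect ρ F Λ₀ β) - (a - expect ρ F Λ₀ β)‖ := by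
        rw [sub_sub_sub_cancel_right]
    _ ≤ ‖texpect ρ (L + 1) F β - expect ρ F Λ₀ β‖ + ‖a - expect ρ F Λ₀ β‖ := norm_sub_le _ _
    _ ≤ 2 * M * (1 / 2) ^ n + 2 * M * (1 / 2) ^ n := add_le_add h1 h2
    _ = 4 * M * (1 / 2) ^ n := by ring


end CrossStab


/-! ### Bookkeeping: cofinality of boxes -/

/-- Boxes are cofinal among the finite regions of `ℤ^d`. [folklore] -/
theorem tendsto_box_atTop_atTop (d : ℕ) : Tendsto (Literature.Probability.LatticeModels.box d) atTop atTop := by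
  refine Filter.tendsto_atTop_atTop.2 fun Λ =>
    ⟨Λ.sup fun x => Finset.univ.sup fun k => (x k).natAbs, fun L hL x hx => ?_⟩
  rw [Literature.Probability.LatticeModels.mem_box]
  intro i
  have h1 : (x i).natAbs ≤ Finset.univ.sup fun k => (x k).natAbs :=
    Finset.le_sup (f := fun k => (x k).natAbs) (Finset.mem_univ i)
  have h2 : (Finset.univ.sup fun k => (x k).natAbs) ≤ Λ.sup fun x => Finset.univ.sup fun k => (x k).natAbs :=
    Finset.le_sup (f := fun x : Literature.Probability.LatticeModels.Site d =>
      Finset.univ.sup fun k => (x k).natAbs) hx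
  have h3 := (h1.trans h2).trans hL
  omega

/-- **Quantitative finite-size control of torus Wilson expectations at strong coupling** (`d = 4`).
There is `μ' > 0` (`μ' = log 2`) such that for every `n` there is `A` (depending on `n` only) with:
for every observable `F`, `|F| ≤ 1`, measurable, depending on at most `n` bonds based in `box 4 R`,
every real `|β| < betaOne 4 ρ / 4`, the box limit `gβ` of the free-boundary expectations
`zdExpect ρ β Λ F` and every `L > R`, the torus Wilson expectation of `F ∘ torusLift` on the torus of
side `2L + 1` is within `A e^{-μ'(L - R)}` of `gβ`. Proof: the torus expectation is
`Re ⟨F ∘ (· ∘ τ)⟩^T_{2L+1}(β)` (`wilsonExpectation_toTorusObservable_eq_re_expect`), `gβ = Re g_F(β)`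
by uniqueness of limits (boxes are cofinal), and `norm_texpect_sub_le` with order `L - R - 3`
(the trivial bound `2 M` for `L - R ≤ 2`); Osterwalder–Seiler 1978, Thms. 3.6–3.7 in quantitative
form. [folklore] -/
theorem TorusFiniteSizeRate : ∀ (N : ℕ) (G : Type) [Group G] [TopologicalSpace G] [IsTopologicalGroup G] [CompactSpace G] [T2Space G] [SecondCountableTopology G] [MeasurableSpace G] [BorelSpace G] (ρ : G →* Matrix (Fin N) (Fin N) ℂ), Continuous ρ → ∃ μ' : ℝ, 0 < μ' ∧ ∀ n : ℕ, ∃ A : ℝ, ∀ (B : Finset (Literature.MathematicalPhysics.QuantumLattice.ZdEdge 4)) (R : ℕ), B.card ≤ n → (∀ e ∈ B, e.1 ∈ Literature.Probability.LatticeModels.box 4 R) → ∀ (F : Literature.MathematicalPhysics.QuantumFieldTheory.ZdGaugeConfig 4 G → ℝ), Measurable F → (∀ U, |F U| ≤ 1) → DependsOn F (B : Set (Literature.MathematicalPhysics.QuantumLattice.ZdEdge 4)) → ∀ (β gβ : ℝ), |β| < betaOne 4 ρ / 4 → Literature.Probability.LatticeModels.HasBoxLimit (fun Λ => Literature.MathematicalPhysics.QuantumFieldTheory.zdExpect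 ρ β Λ F) gβ → ∀ L : ℕ, R < L → |Literature.MathematicalPhysics.QuantumFieldTheory.wilsonExpectation (d := 4) (L := 2 * L + 1) ρ β (Literature.MathematicalPhysics.QuantumLattice.toTorusObservable (2 * L + 1) F) - gβ| ≤ A * Real.exp (-(μ' * ((L : ℝ) - R))) := by
  intro N G _ _ _ _ _ _ _ _ ρ hρ
  refine ⟨Real.log 2, Real.log_pos one_lt_two, fun n => ?_⟩
  have hK1 : (1 : ℝ) ≤ 2 * Real.exp (1 / 2) := by
    have := Real.one_le_exp (show (0 : ℝ) ≤ 1 / 2 by norm_num)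
    linarith
  have hM₀1 : (1 : ℝ) ≤ (2 * Real.exp (1 / 2)) ^ (n * (2 ^ 4 * (4 * 4))) := one_le_pow₀ hK1
  refine ⟨32 * (2 * Real.exp (1 / 2)) ^ (n * (2 ^ 4 * (4 * 4))), ?_⟩
  intro B R hBn hBR F hFm hFb hFB β gβ hβ hlim L hRL
  -- complexification of the observable
  set Fc : ZdGaugeConfig 4 G → ℂ := fun U => (F U : ℂ) with hFc
  have hFcm : Measurable Fc := Complex.measurable_ofReal.comp hFm
  have hFcb : ∀ U, ‖Fc U‖ ≤ 1 := fun U => by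
    simp only [hFc, Complex.norm_real, Real.norm_eq_abs]
    exact hFb U
  have hFcB : DependsOn Fc (B : Set (ZdEdge 4)) := fun U V h => by simp only [hFc, hFB h]
  have hβc : ‖(β : ℂ)‖ < betaOne 4 ρ / 4 := by rwa [Complex.norm_real, Real.norm_eq_abs]
  have hb0 : 0 < betaOne 4 ρ := betaOne_pos 4
  have hβ1 : ‖(β : ℂ)‖ ≤ betaOne 4 ρ := by linarith [hβc.le]
  -- the free infinite-volume limit at `β` and its identification with `gβ`
  obtain ⟨g, -, hZ, -⟩ := torus_tendsto_expect hρ hFcm hFcb hFcB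
  have ha : Tendsto (fun Λ => expect ρ Fc Λ β) atTop (𝓝 (g β)) := hZ β hβc
  have hre : ∀ Λ, zdExpect ρ β Λ F = (expect ρ Fc Λ β).re := fun Λ => by
    rw [zdExpect_eq hρ β Λ hFm hFb]
    rfl
  have h1 : Tendsto (fun L : ℕ => (expect ρ Fc (Literature.Probability.LatticeModels.box 4 L) β).re) atTop
      (𝓝 (g β).re) :=
    (Complex.continuous_re.tendsto _).comp (ha.comp (tendsto_box_atTop_atTop 4))
  have h2 : Tendsto (fun L : ℕ => (expect ρ Fc (Literature.Probability.LatticeModels.box 4 L) β).re) atTop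
      (𝓝 gβ) :=
    Filter.Tendsto.congr (fun L => hre (Literature.Probability.LatticeModels.box 4 L)) hlim
  have hg : gβ = (g β).re := tendsto_nhds_unique h2 h1
  -- the torus Wilson expectation as the real part of the torus expectation of the twisted observable
  have hT : wilsonExpectation (L := 2 * L + 1) ρ β (QuantumLattice.toTorusObservable (2 * L + 1) F) =
      (texpect ρ (2 * L + 1) Fc β).re :=
    wilsonExpectation_toTorusObservable_eq_re_expect (L := 2 * L + 1) ρ hρ β hFm hFb
  -- the uniform bound depends on `n` only
  have hMM₀ : (1 : ℝ) * (2 * Real.exp (1 / 2)) ^ (Plaq.seedsOf B).card ≤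
      (2 * Real.exp (1 / 2)) ^ (n * (2 ^ 4 * (4 * 4))) := by
    rw [one_mul]
    exact pow_le_pow_right₀ hK1 ((StrongCouplingShape.card_seedsOf_le B).trans (Nat.mul_le_mul_right _ hBn))
  have hexp : Real.exp (-(Real.log 2 * ((L : ℝ) - R))) = (1 / 2 : ℝ) ^ (L - R) := by
    rw [← Nat.cast_sub hRL.le, Real.exp_neg, mul_comm, Real.exp_nat_mul, Real.exp_log two_pos, one_div,
      inv_pow]
  rw [hT, hg, ← Complex.sub_re, hexp]
  refine (Complex.abs_re_le_norm _).trans ?_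
  by_cases h3 : R + 3 ≤ L
  · -- the main case: order `L - R - 3`
    have hBc : ∀ e ∈ B, ∀ k, (e.1 k - (0 : Literature.Probability.LatticeModels.Site 4) k).natAbs ≤ R := by
      intro e he k
      have := (Literature.Probability.LatticeModels.mem_box.1 (hBR e he)) k
      simp only [Pi.zero_apply, sub_zero]
      omega
    have hmain := norm_texpect_sub_le hρ hFcm hFcb hFcB (n := L - R - 3) (L := 2 * L) hBc (by omega) hβc.le ha
    calc ‖texpect ρ (2 * L + 1) Fc ↑β - g ↑β‖
        ≤ 4 * (1 * (2 * Real.exp (1 / 2)) ^ (Plaq.seedsOf B).card) * (1 / 2) ^ (L - R - 3) := hmain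
      _ ≤ 4 * (2 * Real.exp (1 / 2)) ^ (n * (2 ^ 4 * (4 * 4))) * (1 / 2) ^ (L - R - 3) := by gcongr
      _ = 32 * (2 * Real.exp (1 / 2)) ^ (n * (2 ^ 4 * (4 * 4))) * (1 / 2) ^ (L - R) := by
          obtain ⟨m, hm⟩ : ∃ m : ℕ, m = L - R - 3 := ⟨_, rfl⟩
          have e : L - R = m + 3 := by omega
          rw [← hm, e, pow_add]
          ring
  · -- small `L - R`: the trivial bound
    have hn1 : ‖texpect ρ (2 * L + 1) Fc ↑β‖ ≤ 1 * (2 * Real.exp (1 / 2)) ^ (Plaq.seedsOf B).card :=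
      norm_texpect_le hρ hβ1 (2 * L) hFcm hFcb hFcB
    have hn2 : ‖g ↑β‖ ≤ 1 * (2 * Real.exp (1 / 2)) ^ (Plaq.seedsOf B).card :=
      le_of_tendsto' ha.norm fun Λ => norm_expect_le hρ hβ1 hFcm hFcb hFcB Λ
    have hLR : L - R ≤ 2 := by omega
    have hpow : (1 / 2 : ℝ) ^ 2 ≤ (1 / 2) ^ (L - R) :=
      pow_le_pow_of_le_one (by norm_num) (by norm_num) hLR
    calc ‖texpect ρ (2 * L + 1) Fc ↑β - g ↑β‖
        ≤ 1 * (2 * Real.exp (1 / 2)) ^ (Plaq.seedsOf B).card + 1 * (2 * Real.exp (1 / 2)) ^ (Plaq.seedsOf B).card :=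
          (norm_sub_le _ _).trans (add_le_add hn1 hn2)
      _ ≤ 32 * (2 * Real.exp (1 / 2)) ^ (n * (2 ^ 4 * (4 * 4))) * (1 / 2) ^ 2 := by nlinarith
      _ ≤ 32 * (2 * Real.exp (1 / 2)) ^ (n * (2 ^ 4 * (4 * 4))) * (1 / 2) ^ (L - R) := by gcongr

end Summit.QuantumFields.YangMills.Theorems.CurvatureKernel

end
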